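import Mathlib
import Summits.NavierStokesRegularity.NavierStokesRegularity.Theorems.TaoLadderRungTwoFlatGappedFrontRobustTailZoneOn
import Summits.NavierStokesRegularity.NavierStokesRegularity.Theorems.TaoLadderRungTwoFlatGappedFrontRobustStepTransferOn
import HarnessLib

/-!
# Shift-set pseudo-flows `PseudoFlowOnShift 𝕊`: the PSEUDO-FLOW'S TAIL ON AN INITIAL WINDOW and one-shell
  energy / defect bounds (helper for item stmt-NavierStokesRegularity-22988 `GappedFrontRobustV2Flat`,
  crux K_B♭ of route TaoLadderRungTwoFlat)

The `𝕊`-parametrised version of `Theorems/TaoLadderRungThreeGappedFrontRobustPseudoBounds.lean` (p1 g10,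
one-way `S`). `pseudoFlowOnShift_tail_on_window`: the tail zone on `𝕊` (`pseudoFlowOnShift_tail_zone`,
`…_energy`) applied to the pseudo-flow RESTRICTED to `[0, t]` (`pseudoFlowOnShift_mono`) with the
two-valued profile `ν₀ + 2ψ_M` (base shell: exact bound + weak deviation) / `ν` (above): the closing
condition (with the backscatter factor `2`) and the slowness condition are required for the clock `c ≥ τ`
at the two values `x ∈ {ν₀ + 2ψ_M, ν}` and transported to the window by monotonicity. Also:
`pseudoFlowOnShift_slack_nonneg`, `pseudoFlowOnShift_energy_le_three` (`F ≤ 3(a²/2 + b)` from an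
amplitude bound when `κ₂ (1+ε₀)^{2n} τ ≤ 1`), `pseudoFlowOnShift_defect_integral_le`.

HONEST FRAMING: elementary lemmas about Tao-type MODEL lattice pseudo-flows (Tao 2016 §4 Lemma 4.1 (4.5),
(4.8)–(4.10) with (4.3), §6.2 Prop. 6.3 (ix)) on a general nearest-neighbour shift set; nothing here is a
statement about the Navier–Stokes equations, and nothing is asserted about any table (p1 g12).
-/

noncomputable section

-- the sub-problem namespace `Summit.NavierStokesRegularity.NavierStokesRegularity` repeats the summit name by design (D-0017)
set_option linter.dupNamespace false

namespace Summit.NavierStokesRegularity.NavierStokesRegularity.Theorems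

open Set MeasureTheory intervalIntegral Literature.Analysis.FluidPDE Literature.Analysis.FluidPDE.TaoCascade

namespace GappedFrontRobustOn

variable {m : ℕ} {𝕊 : Finset (ℤ × ℤ × ℤ)}
variable {τ ε₀ : ℝ} {α : Fin m → Fin m → Fin m → ℤ × ℤ × ℤ → ℝ} {κ₁ κ₂ : ℝ}
  {S₀ F₀ B₀ : Fin m → ℤ → ℝ} {S F S' : Fin m → ℤ → ℝ → ℝ}

/-! ### The pseudo-flow's tail zone on an initial window -/

/-- **THE PSEUDO-FLOW'S TAIL ZONE ON `[0, t]` FROM A WEAK DEVIATION AT THE BASE SHELL.** See the module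
docstring. Data beyond the tail zone's: a second family `S'` (the exact flow) bounded at the base shell by
`ν₀ r/w(k₂−2)` on `[0, τ]`, and on `[0, t]` (`0 < t ≤ τ ≤ c`) the deviation `|S − S'| ≤ 2 ψ_M r/w(k₂−2)` at the
base shell; the closing condition for the clock `c` at the two values `x ∈ {ν₀ + 2ψ_M, ν}`. Conclusion: for
every `K ≥ k₂`, `u ∈ [0, t]`: `|S_{i,K}(u)| ≤ ν r/w(K−1)` and `∑_i F_{i,K}(u) ≤ (ν r/w(K−1))²/2`.
[cite: Tao2016AveragedNS, §4 Lemma 4.1 (4.5), (4.9)–(4.10) with (4.3) and §6.2 Prop. 6.3 (ix)] -/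
theorem pseudoFlowOnShift_tail_on_window (h𝕊 : IsNearestNeighbourSet 𝕊) (h𝕊c : IsSlotClosed 𝕊)
    (h111 : ((1 : ℤ), (1 : ℤ), (1 : ℤ)) ∉ 𝕊) (h : PseudoFlowOnShift 𝕊 τ ε₀ α κ₁ κ₂ S₀ F₀ B₀ S F)
    (hε : 0 < ε₀) (hα : IsCancellingCoeffOn 𝕊 α) {w : ℤ → ℝ} {z : Fin m → ℤ → ℝ}
    {r β ϑ c ν ν₀ ψM : ℝ} {k₁ k₂ : ℤ}
    (hr : 0 ≤ r) (hβ : 0 ≤ β) (hw : ∀ k, 0 < w k) (hν : 0 ≤ ν) (hν₀ : 0 ≤ ν₀) (hψM : 0 ≤ ψM)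
    (hT1 : ∀ k : ℤ, k₁ ≤ k → 2 * (1 + ε₀) ^ (k : ℝ) * w k ≤ w (k + 1))
    (hT2 : ∀ k : ℤ, k₁ ≤ k → ∀ i, 4 * (w k * |z i k|) ≤ r)
    (hball : ∀ i k, w k * |S₀ i k - z i k| ≤ r)
    (hB₀ : ∀ i k, k₂ - 1 ≤ k → B₀ i k ≤ β * (1 + ε₀) ^ ((2 : ℝ) * k) * r ^ 2 / w k ^ 2)
    (hthin : ∀ K : ℤ, k₂ ≤ K → (1 + ε₀) ^ ((5 : ℝ) * K / 2) * r * w (K - 1) ≤ ϑ * w (K - 2) ^ 2)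
    (hk₂ : k₁ ≤ k₂ - 1) (hk₂' : 2 ≤ k₂) (hτc : τ ≤ c)
    (hclose : ∀ K : ℤ, k₂ ≤ K → ∀ x : ℝ, (x = ν₀ + 2 * ψM ∨ x = ν) →
      2 * (Real.sqrt 2 * Real.sqrt (4 / 3 * m * (25 / 32 + β * (1 + ε₀) ^ ((2 : ℝ) * K))) /
          (2 * (1 + ε₀) ^ ((K - 1 : ℤ) : ℝ)) +
        coeffAbsOn (botShifts 𝕊) α * c * (ϑ / (1 + ε₀) ^ ((5 : ℝ) / 2)) * x ^ 2) ≤ ν)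
    (hslow : ∀ K : ℤ, k₂ ≤ K → ∀ x : ℝ, (x = ν₀ + 2 * ψM ∨ x = ν) →
      (1 + ε₀) ^ ((5 : ℝ) * (K - 1 : ℤ) / 2) * coeffAbsOn (botShifts 𝕊) α * c *
        (x * r / w (K - 2)) ≤ 1 / 2)
    (hbaseE : ∀ u ∈ Icc 0 τ, ∀ i : Fin m, |S' i (k₂ - 1) u| ≤ ν₀ * r / w (k₂ - 2))
    {t : ℝ} (ht : t ∈ Icc 0 τ) (ht0 : 0 < t)
    (hdev : ∀ s ∈ Icc 0 t, ∀ i : Fin m, |S i (k₂ - 1) s - S' i (k₂ - 1) s| ≤ 2 * ψM * (r / w (k₂ - 2))) :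
    (∀ K : ℤ, k₂ ≤ K → ∀ u ∈ Icc 0 t, ∀ i : Fin m, |S i K u| ≤ ν * r / w (K - 1)) ∧
      (∀ K : ℤ, k₂ ≤ K → ∀ u ∈ Icc 0 t, ∑ i, F i K u ≤ (ν * r / w (K - 1)) ^ 2 / 2) := by
  have hq : 0 < 1 + ε₀ := by linarith
  set C : ℝ := coeffAbsOn (botShifts 𝕊) α with hC
  have hC0 : 0 ≤ C := coeffAbsOn_nonneg _ _
  -- restrict the flow to [0, t]
  have hP := pseudoFlowOnShift_mono h ht0 ht.2
  -- the target profile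
  set νf : ℤ → ℝ := fun K => if K < k₂ then ν₀ + 2 * ψM else ν with hνf
  have hνf0 : ∀ K : ℤ, k₂ - 1 ≤ K → 0 ≤ νf K := fun K _ => by
    simp only [hνf]; split_ifs
    · positivity
    · exact hν
  have hT1' : ∀ k : ℤ, k₂ - 1 ≤ k → 2 * (1 + ε₀) ^ (k : ℝ) * w k ≤ w (k + 1) :=
    fun k hk => hT1 k (by linarith)
  have hT2' : ∀ k : ℤ, k₂ - 1 ≤ k → ∀ i, 4 * (w k * |z i k|) ≤ r := fun k hk => hT2 k (by linarith)
  -- the closing condition on the window [0, t]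
  have hx_all : ∀ K : ℤ, νf (K - 1) = ν₀ + 2 * ψM ∨ νf (K - 1) = ν := fun K => by
    simp only [hνf]; split_ifs
    · exact Or.inl rfl
    · exact Or.inr rfl
  have hslow' : ∀ K : ℤ, k₂ ≤ K →
      (1 + ε₀) ^ ((5 : ℝ) * (K - 1 : ℤ) / 2) * C * t * (νf (K - 1) * r / w (K - 2)) ≤ 1 / 2 := by
    intro K hK
    have h1 := hslow K hK (νf (K - 1)) (hx_all K)
    have htc : t ≤ c := ht.2.trans hτc
    have hfac : 0 ≤ (1 + ε₀) ^ ((5 : ℝ) * (K - 1 : ℤ) / 2) * C * (νf (K - 1) * r / w (K - 2)) := by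
      have := Real.rpow_pos_of_pos hq ((5 : ℝ) * (K - 1 : ℤ) / 2); have := hνf0 (K - 1) (by linarith)
      have := hw (K - 2); positivity
    have hmono := mul_le_mul_of_nonneg_left htc hfac
    calc (1 + ε₀) ^ ((5 : ℝ) * (K - 1 : ℤ) / 2) * C * t * (νf (K - 1) * r / w (K - 2))
        = (1 + ε₀) ^ ((5 : ℝ) * (K - 1 : ℤ) / 2) * C * (νf (K - 1) * r / w (K - 2)) * t := by ring
      _ ≤ (1 + ε₀) ^ ((5 : ℝ) * (K - 1 : ℤ) / 2) * C * (νf (K - 1) * r / w (K - 2)) * c := hmono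
      _ = (1 + ε₀) ^ ((5 : ℝ) * (K - 1 : ℤ) / 2) * C * c * (νf (K - 1) * r / w (K - 2)) := by ring
      _ ≤ 1 / 2 := h1
  have hclose' : ∀ K : ℤ, k₂ ≤ K →
      2 * (Real.sqrt 2 * Real.sqrt (4 / 3 * m * (25 / 32 + β * (1 + ε₀) ^ ((2 : ℝ) * K))) /
          (2 * (1 + ε₀) ^ ((K - 1 : ℤ) : ℝ)) +
        C * t * (ϑ / (1 + ε₀) ^ ((5 : ℝ) / 2)) * νf (K - 1) ^ 2) ≤ νf K := by
    intro K hK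
    have hx : νf (K - 1) = ν₀ + 2 * ψM ∨ νf (K - 1) = ν := by
      simp only [hνf]; split_ifs
      · exact Or.inl rfl
      · exact Or.inr rfl
    have h1 := hclose K hK (νf (K - 1)) hx
    have hK' : νf K = ν := by simp only [hνf, show ¬ (K < k₂) from not_lt.mpr hK, if_false]
    rw [hK']
    -- the pumping term is monotone in the window length; ϑ ≥ 0 from the thin-tail inequality
    have hϑ : 0 ≤ ϑ := by
      have h2 := hthin K hK
      have hl : 0 ≤ (1 + ε₀) ^ ((5 : ℝ) * K / 2) * r * w (K - 1) := by
        have := Real.rpow_pos_of_pos hq ((5 : ℝ) * K / 2); have := hw (K - 1); positivity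
      have hw2 := pow_pos (hw (K - 2)) 2
      nlinarith
    have htc : t ≤ c := ht.2.trans hτc
    have hfac : 0 ≤ C * (ϑ / (1 + ε₀) ^ ((5 : ℝ) / 2)) * νf (K - 1) ^ 2 := by
      have := Real.rpow_pos_of_pos hq ((5 : ℝ) / 2); positivity
    have hmono : C * t * (ϑ / (1 + ε₀) ^ ((5 : ℝ) / 2)) * νf (K - 1) ^ 2 ≤
        C * c * (ϑ / (1 + ε₀) ^ ((5 : ℝ) / 2)) * νf (K - 1) ^ 2 := by
      have := mul_le_mul_of_nonneg_left htc hfac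
      nlinarith
    linarith
  -- the base bound on [0, t]
  have hbase : ∀ u ∈ Icc 0 t, ∀ i, |S i (k₂ - 1) u| ≤ νf (k₂ - 1) * r / w (k₂ - 2) := by
    intro u hu i
    have h1 := hbaseE u ⟨hu.1, hu.2.trans ht.2⟩ i
    have h2 := hdev u hu i
    have h3 : |S i (k₂ - 1) u| ≤ |S' i (k₂ - 1) u| + |S i (k₂ - 1) u - S' i (k₂ - 1) u| := by
      have := abs_add_le (S' i (k₂ - 1) u) (S i (k₂ - 1) u - S' i (k₂ - 1) u); simpa using this
    have hk : νf (k₂ - 1) = ν₀ + 2 * ψM := by simp only [hνf, show k₂ - 1 < k₂ by linarith, if_true]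
    rw [hk]
    have : (ν₀ + 2 * ψM) * r / w (k₂ - 2) = ν₀ * r / w (k₂ - 2) + 2 * ψM * (r / w (k₂ - 2)) := by ring
    rw [this]; linarith
  have hk₂1 : k₂ - 1 + 1 ≤ k₂ := by linarith
  refine ⟨fun K hK u hu i => ?_, fun K hK u hu => ?_⟩
  · have := pseudoFlowOnShift_tail_zone h𝕊 h𝕊c h111 hP ht0 hε hα hr hβ hw hT1' hT2' hball hB₀ hthin hk₂1
      hk₂' hνf0 hclose' hslow' hbase K (by linarith) u hu i
    have hK' : νf K = ν := by simp only [hνf, show ¬ (K < k₂) from not_lt.mpr hK, if_false]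
    rwa [hK'] at this
  · have := pseudoFlowOnShift_tail_zone_energy h𝕊 h𝕊c h111 hP ht0 hε hα hr hβ hw hT1' hT2' hball hB₀
      hthin hk₂1 hk₂' hνf0 hclose' hslow' hbase hK hu
    have hK' : νf K = ν := by simp only [hνf, show ¬ (K < k₂) from not_lt.mpr hK, if_false]
    rwa [hK'] at this

/-! ### One shell: energy and motion defect from an amplitude bound -/

/-- The accumulated slack of a pseudo-flow is nonnegative (from (4.10) at time `0`, `τ ≥ 0`).
[cite: Tao2016AveragedNS, §4 Lemma 4.1 (4.10)] -/
theorem pseudoFlowOnShift_slack_nonneg (h : PseudoFlowOnShift 𝕊 τ ε₀ α κ₁ κ₂ S₀ F₀ B₀ S F) (hτ : 0 ≤ τ)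
    (i : Fin m) (k : ℤ) : 0 ≤ B₀ i k := by
  have h0 : (0 : ℝ) ∈ Icc 0 τ := ⟨le_rfl, hτ⟩
  have h1 := h.defect_lower i k 0 h0
  have h2 := h.defect_upper i k 0 h0
  rw [intervalIntegral.integral_same, mul_zero, add_zero] at h2
  linarith

/-- **Energy of one shell from an amplitude bound**: if `|S_{i,n}| ≤ a` on `[0, t]` (`t ≤ τ`), `B₀_{i,n} ≤ b`,
`κ₂ ≥ 0` and `κ₂ (1+ε₀)^{2n} τ ≤ 1` (`ε₀ > −1`), then `F_{i,n}(u) ≤ 3 (a²/2 + b)` for `u ∈ [0, t]`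
(`pseudoFlowOnShift_energy_le_exp` and `e ≤ 3`). [cite: Tao2016AveragedNS, §4 Lemma 4.1 (4.10)] -/
theorem pseudoFlowOnShift_energy_le_three (h : PseudoFlowOnShift 𝕊 τ ε₀ α κ₁ κ₂ S₀ F₀ B₀ S F) (hε : 0 < 1 + ε₀)
    (hκ₂ : 0 ≤ κ₂) (i : Fin m) (n : ℤ) {t a b : ℝ} (ht : t ∈ Icc 0 τ)
    (ha : ∀ u ∈ Icc 0 t, |S i n u| ≤ a) (hb : B₀ i n ≤ b)
    (hsmall : κ₂ * (1 + ε₀) ^ ((2 : ℝ) * n) * τ ≤ 1) :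
    ∀ u ∈ Icc 0 t, F i n u ≤ 3 * (a ^ 2 / 2 + b) := by
  intro u hu
  have hA : ∀ v ∈ Icc 0 t, (1 / 2) * S i n v ^ 2 ≤ a ^ 2 / 2 := by
    intro v hv
    have h1 := ha v hv
    have h2 : S i n v ^ 2 ≤ a ^ 2 := by
      rw [← sq_abs]; exact pow_le_pow_left₀ (abs_nonneg _) h1 2
    linarith
  have h1 := pseudoFlowOnShift_energy_le_exp h hε hκ₂ i n ht hA u hu
  have hB0 := pseudoFlowOnShift_slack_nonneg h (ht.1.trans ht.2) i n
  -- the exponent is at most 1 on [0, t] ⊆ [0, τ]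
  have hexp : Real.exp (κ₂ * (1 + ε₀) ^ ((2 : ℝ) * n) * u) ≤ 3 := by
    have hk0 : 0 ≤ κ₂ * (1 + ε₀) ^ ((2 : ℝ) * n) := mul_nonneg hκ₂ (Real.rpow_pos_of_pos hε _).le
    have hu' : u ≤ τ := hu.2.trans ht.2
    have h2 : κ₂ * (1 + ε₀) ^ ((2 : ℝ) * n) * u ≤ 1 := by
      have := mul_le_mul_of_nonneg_left hu' hk0; linarith
    have h3 := Real.exp_le_exp.mpr h2
    have h4 : Real.exp 1 < 3 := by
      have := Real.exp_one_lt_d9; norm_num at this ⊢; linarith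
    linarith
  have hpos : 0 ≤ a ^ 2 / 2 + B₀ i n := by positivity
  calc F i n u ≤ (a ^ 2 / 2 + B₀ i n) * Real.exp (κ₂ * (1 + ε₀) ^ ((2 : ℝ) * n) * u) := h1
    _ ≤ (a ^ 2 / 2 + B₀ i n) * 3 := mul_le_mul_of_nonneg_left hexp hpos
    _ ≤ 3 * (a ^ 2 / 2 + b) := by linarith

/-- **Motion defect of one shell from an amplitude bound**: under the hypotheses of
`pseudoFlowOnShift_energy_le_three` and `κ₁ ≥ 0`,
`∫₀ᵗ κ₁ (1+ε₀)^{2n} √F_{i,n} ≤ t κ₁ (1+ε₀)^{2n} √(3 (a²/2 + b))`.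
[cite: Tao2016AveragedNS, §4 Lemma 4.1 (4.8), (4.10)] -/
theorem pseudoFlowOnShift_defect_integral_le (h : PseudoFlowOnShift 𝕊 τ ε₀ α κ₁ κ₂ S₀ F₀ B₀ S F) (hε : 0 < 1 + ε₀)
    (hκ₁ : 0 ≤ κ₁) (hκ₂ : 0 ≤ κ₂) (i : Fin m) (n : ℤ) {t a b : ℝ} (ht : t ∈ Icc 0 τ)
    (ha : ∀ u ∈ Icc 0 t, |S i n u| ≤ a) (hb : B₀ i n ≤ b)
    (hsmall : κ₂ * (1 + ε₀) ^ ((2 : ℝ) * n) * τ ≤ 1) :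
    ∫ u in (0 : ℝ)..t, κ₁ * (1 + ε₀) ^ ((2 : ℝ) * n) * Real.sqrt (F i n u) ≤
      t * (κ₁ * (1 + ε₀) ^ ((2 : ℝ) * n) * Real.sqrt (3 * (a ^ 2 / 2 + b))) := by
  have hF := pseudoFlowOnShift_energy_le_three h hε hκ₂ i n ht ha hb hsmall
  have hk0 : 0 ≤ κ₁ * (1 + ε₀) ^ ((2 : ℝ) * n) := mul_nonneg hκ₁ (Real.rpow_pos_of_pos hε _).le
  have hsub : uIcc 0 t ⊆ Icc 0 τ := by rw [uIcc_of_le ht.1]; exact Icc_subset_Icc_right ht.2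
  have hcont : ContinuousOn (fun u => κ₁ * (1 + ε₀) ^ ((2 : ℝ) * n) * Real.sqrt (F i n u)) (Icc 0 τ) :=
    continuousOn_const.mul (h.contDiffOn_F i n).continuousOn.sqrt
  have hint : IntervalIntegrable (fun u => κ₁ * (1 + ε₀) ^ ((2 : ℝ) * n) * Real.sqrt (F i n u)) volume 0 t :=
    (hcont.mono hsub).intervalIntegrable
  have hpt : ∀ u ∈ Icc 0 t, κ₁ * (1 + ε₀) ^ ((2 : ℝ) * n) * Real.sqrt (F i n u) ≤
      κ₁ * (1 + ε₀) ^ ((2 : ℝ) * n) * Real.sqrt (3 * (a ^ 2 / 2 + b)) := fun u hu =>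
    mul_le_mul_of_nonneg_left (Real.sqrt_le_sqrt (hF u hu)) hk0
  calc ∫ u in (0 : ℝ)..t, κ₁ * (1 + ε₀) ^ ((2 : ℝ) * n) * Real.sqrt (F i n u)
      ≤ ∫ u in (0 : ℝ)..t, κ₁ * (1 + ε₀) ^ ((2 : ℝ) * n) * Real.sqrt (3 * (a ^ 2 / 2 + b)) :=
        intervalIntegral.integral_mono_on ht.1 hint (by simp) hpt
    _ = t * (κ₁ * (1 + ε₀) ^ ((2 : ℝ) * n) * Real.sqrt (3 * (a ^ 2 / 2 + b))) := by
        rw [intervalIntegral.integral_const, sub_zero, smul_eq_mul]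

end GappedFrontRobustOn

end Summit.NavierStokesRegularity.NavierStokesRegularity.Theorems

end
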